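import Summits.ABC.IUTFork.Repair.ObstructionSS28Budget
import HarnessLib

/-!
# IUT REPAIR branch → R-H (D-0079), abc-iut-rp-s2 lineage — `ObstructionSS28Places`: the slack ledger read with TWO-SIDED columns
# (sufficient / necessary exponents) and PLACE BY PLACE (place-cut budget) — companion of `ObstructionSS28Window` p451819 / `ObstructionSS28Budget` p453881

PROOF-ONLY satellite (own namespace `Summit.ABC.IUTFork.Repair.ObstructionSS28Places`; D-0012: 0 definitions, 0 `Prop` facts; abc-iut cell, rung
LADDER-ABC:A2.RP → A2.RESCUE-H; seat abc-iut-rp-s2 gen 4, ONE-WRITER lane «per-cell slack ledger σ + budget identities» of plan/rescue/R-H/START-HERE.md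
v1.1 §6). TAKES NO SIDE on [IUTchIII] Cor. 3.12 or on any author; candidate readings are bound hypotheses; typed ≠ proved; DEFS-FREEZE respected; inputs
⊆ the frozen FACT-LIST; standard axioms. `σ_{i+1,v_ℚ} := logvol(ⁿ˒°𝒰_{i+1,v_ℚ}) − qLocal_{i+1,v_ℚ}` as in the parent files (spelled out, never defined).

WHAT THIS FILE ADDS.
* §6 TWO-SIDED COLUMNS (abc-iut-rw-num-lead 14:59:41Z relay: the I06⋆ block carries a SUFFICIENT exponent `δ⁻` and a NECESSARY exponent `δ⁺`, never one
  `δ`). Abstractly: cellwise bounds `lo ≤ σ ≤ hi` with finite supports give `0 ≤ PN Σᶠ lo ⟹ Statement` (`statement_of_avg_lower_nonneg`) and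
  `Statement ⟹ 0 ≤ PN Σᶠ hi` (`avg_upper_nonneg_of_statement`); in print's containers reading with two-sided container-volume bounds
  `j²·qLocal + δ⁻ ≤ logvol(⋃_m ρ(Ψ_m·𝓘)) ≤ j²·qLocal + δ⁺` these read **`statement_of_avg_lowerIndex_sub_height_nonneg`** (`0 ≤ PN Σᶠ [δ⁻ − (j²−1)(−qLocal)] ⟹
  Statement`) and **`avg_upperIndex_sub_height_nonneg_of_statement`** (`Statement ⟹ 0 ≤ PN Σᶠ [δ⁺ − (j²−1)(−qLocal)]`): the table's `slack_minus` column summed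
  with PN weights is SUFFICIENT, its `slack_plus` column NECESSARY, for the typed Corollary.
* §7 PER-PLACE LEDGER. `avg_finsum_comm` (average over labels of a finitely supported sum over places = sum over places of the label average),
  **`statement_iff_finsum_placeAvg_nonneg`** (`Statement ↔ 0 ≤ Σᶠ_{v_ℚ} PN(i ↦ σ_{i+1,v_ℚ})`), `finsum_placeAvg_eq_on_add_off` (split over a set of places
  `V₀`), **`statement_iff_place_budget`**, **`statement_of_placeCut_of_budget`** (every cell at the places of `V₀` volume-licensed — e.g. I06⋆ at ALL labels
  there, seed cut (C2) — and «off-`V₀` deficit ≤ on-`V₀` surplus» ⟹ Statement), `place_deficit_le_of_statement` (necessity), and the WORST CASE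
  **`statement_of_placeCut_of_surplus_ge_floorMass`** (off-`V₀` places priced at their floor mass `PN(i ↦ ((i+1)²−1)(−qLocal))` via
  `ObstructionSS28Budget.cellSlack_ge_neg_floor_at`; nothing about the hull off `V₀`). This is the volume budget a PLACE-CUT candidate (abc-iut-rp-j2's
  C2 glue) answers to, place by place.
HONEST SCOPE. Pure bookkeeping over the frozen vocabulary; nothing decides a genuine cell; the container-volume bounds of §6 are INLINE hypotheses on the
binders `δ⁻, δ⁺`. [claim: Mochizuki2012, status: disputed] [cite: ScholzeStix2018, §2.2 p. 10 l. 26–30]. Axioms: standard.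
-/

noncomputable section

open Set

namespace Summit.ABC.IUTFork.Repair.ObstructionSS28Places

open Thm311 Cor312 Cor312Vol Literature.IUT.LogThetaLattice Summit.ABC.IUTFork.Repair.CandInternal2
  Summit.ABC.IUTFork.Repair.CandInternal11Gap Summit.ABC.IUTFork.Repair.CandInternal11GapWindow
  Summit.ABC.IUTFork.Repair.ObstructionSS28Window Summit.ABC.IUTFork.Repair.ObstructionSS28Budget

variable {T : ThetaIndex} (S : LatticeSituation T) (P : Cor312.Setting S.toSituation)
  (ρ : (∀ v : T.V, v ∈ T.Vbad → Set (S.L.StarPacket v)) → ∀ (j : T.Label) (vQ : T.VQ), Set (S.L.Packet j vQ))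
  (qK : ∀ v : T.V, v ∈ T.Vbad → Set (S.L.StarPacket v))

/-! ## §6. Two-sided columns: a sufficient lower ledger and a necessary upper ledger -/

section TwoSided

variable (lo hi : Fin T.lstar → T.VQ → ℝ)

/-- **SUFFICIENT COLUMN.** If a finitely supported cellwise LOWER bound `lo ≤ σ` has nonnegative PN-sum, the typed Statement holds (`ThetaFinite`).
[claim: Mochizuki2012, status: disputed] -/
theorem statement_of_avg_lower_nonneg (hfin : P.ThetaFinite) (hlo : ∀ i : Fin T.lstar, (Function.support (lo i)).Finite)
    (hle : ∀ (i : Fin T.lstar) (vQ : T.VQ),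
      lo i vQ ≤ (S.D P.n).logvol _ vQ (P.thetaHull (Setting.labelSucc i) vQ) - P.qLocal (Setting.labelSucc i) vQ)
    (h : 0 ≤ processionNormalized (fun i : Fin T.lstar => ∑ᶠ vQ : T.VQ, lo i vQ)) : P.Statement := by
  rw [statement_iff_avg_cellSlack S P hfin]
  exact h.trans (processionNormalized_mono fun i =>
    finsum_le_finsum' (hlo i) (cellSlack_support_finite S P hfin i) fun vQ => hle i vQ)

/-- **NECESSARY COLUMN.** If the typed Statement holds, every finitely supported cellwise UPPER bound `σ ≤ hi` has nonnegative PN-sum (`ThetaFinite`).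
[claim: Mochizuki2012, status: disputed] -/
theorem avg_upper_nonneg_of_statement (hfin : P.ThetaFinite) (hhi : ∀ i : Fin T.lstar, (Function.support (hi i)).Finite)
    (hge : ∀ (i : Fin T.lstar) (vQ : T.VQ),
      (S.D P.n).logvol _ vQ (P.thetaHull (Setting.labelSucc i) vQ) - P.qLocal (Setting.labelSucc i) vQ ≤ hi i vQ)
    (hS : P.Statement) : 0 ≤ processionNormalized (fun i : Fin T.lstar => ∑ᶠ vQ : T.VQ, hi i vQ) :=
  ((statement_iff_avg_cellSlack S P hfin).1 hS).trans (processionNormalized_mono fun i =>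
    finsum_le_finsum' (cellSlack_support_finite S P hfin i) (hhi i) fun vQ => hge i vQ)

variable (δlo δhi : Fin T.lstar → T.VQ → ℝ)

/-- **SUFFICIENT EXPONENT (containers currency).** In print's containers reading (hull = log-shell orbit of the Θ-data at every cell of `𝔽_l^⋇`) with a
cellwise LOWER container-volume bound `(i+1)²·qLocal + δ⁻ ≤ logvol(⋃_m ρ(Ψ_m·𝓘))` (`δ⁻` finitely supported — at genuine data the sufficient shell exponent
of the table's `kappa_minus`/`slack_minus` columns, in volume units): `0 ≤ PN Σᶠ [δ⁻ − ((i+1)² − 1)·(−qLocal)] ⟹ Statement`. [claim: Mochizuki2012, status: disputed] -/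
theorem statement_of_avg_lowerIndex_sub_height_nonneg (hfin : P.ThetaFinite)
    (hδ : ∀ i : Fin T.lstar, (Function.support (δlo i)).Finite)
    (hhull : ∀ (i : Fin T.lstar) (vQ : T.VQ),
      P.thetaHull (Setting.labelSucc i) vQ = ⋃ m : ℤ, ρ (shellSat S P.n ((S.col P.n).frobΨ m)) (Setting.labelSucc i) vQ)
    (hcont : ∀ (i : Fin T.lstar) (vQ : T.VQ),
      (((i : ℕ) + 1 : ℕ) : ℝ) ^ 2 * P.qLocal (Setting.labelSucc i) vQ + δlo i vQ ≤
        (S.D P.n).logvol _ vQ (⋃ m : ℤ, ρ (shellSat S P.n ((S.col P.n).frobΨ m)) (Setting.labelSucc i) vQ))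
    (h : 0 ≤ processionNormalized (fun i : Fin T.lstar =>
        ∑ᶠ vQ : T.VQ, (δlo i vQ - ((((i : ℕ) + 1 : ℕ) : ℝ) ^ 2 - 1) * (-P.qLocal (Setting.labelSucc i) vQ)))) :
    P.Statement := by
  refine statement_of_avg_lower_nonneg S P _ hfin (fun i => ?_) (fun i vQ => ?_) h
  · refine ((hδ i).union (floor_support_finite S P i)).subset fun vQ hvQ => ?_
    by_contra hn
    simp only [Set.mem_union, Function.mem_support, not_or, not_not] at hn
    exact hvQ (by simp only [hn.1, hn.2, sub_zero])
  · have hc := hcont i vQ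
    rw [← hhull i vQ] at hc
    linarith

/-- **NECESSARY EXPONENT (containers currency).** With a cellwise UPPER container-volume bound `logvol(⋃_m ρ(Ψ_m·𝓘)) ≤ (i+1)²·qLocal + δ⁺` (`δ⁺` finitely
supported — the necessary shell exponent of the table's `kappa_plus`/`slack_plus` columns): `Statement ⟹ 0 ≤ PN Σᶠ [δ⁺ − ((i+1)² − 1)·(−qLocal)]`.
[claim: Mochizuki2012, status: disputed] -/
theorem avg_upperIndex_sub_height_nonneg_of_statement (hfin : P.ThetaFinite)
    (hδ : ∀ i : Fin T.lstar, (Function.support (δhi i)).Finite)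
    (hhull : ∀ (i : Fin T.lstar) (vQ : T.VQ),
      P.thetaHull (Setting.labelSucc i) vQ = ⋃ m : ℤ, ρ (shellSat S P.n ((S.col P.n).frobΨ m)) (Setting.labelSucc i) vQ)
    (hcont : ∀ (i : Fin T.lstar) (vQ : T.VQ),
      (S.D P.n).logvol _ vQ (⋃ m : ℤ, ρ (shellSat S P.n ((S.col P.n).frobΨ m)) (Setting.labelSucc i) vQ) ≤
        (((i : ℕ) + 1 : ℕ) : ℝ) ^ 2 * P.qLocal (Setting.labelSucc i) vQ + δhi i vQ)
    (hS : P.Statement) :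
    0 ≤ processionNormalized (fun i : Fin T.lstar =>
        ∑ᶠ vQ : T.VQ, (δhi i vQ - ((((i : ℕ) + 1 : ℕ) : ℝ) ^ 2 - 1) * (-P.qLocal (Setting.labelSucc i) vQ))) := by
  refine avg_upper_nonneg_of_statement S P _ hfin (fun i => ?_) (fun i vQ => ?_) hS
  · refine ((hδ i).union (floor_support_finite S P i)).subset fun vQ hvQ => ?_
    by_contra hn
    simp only [Set.mem_union, Function.mem_support, not_or, not_not] at hn
    exact hvQ (by simp only [hn.1, hn.2, sub_zero])
  · have hc := hcont i vQ
    rw [← hhull i vQ] at hc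
    linarith

end TwoSided

/-! ## §7. The ledger place by place -/

section Places

/-- **Average over labels of a finitely supported sum over places = sum over places of the label average.** [folklore] -/
theorem avg_finsum_comm {b : Fin T.lstar → T.VQ → ℝ} (hb : ∀ i : Fin T.lstar, (Function.support (b i)).Finite) :
    processionNormalized (fun i : Fin T.lstar => ∑ᶠ vQ : T.VQ, b i vQ) =
      ∑ᶠ vQ : T.VQ, processionNormalized (fun i : Fin T.lstar => b i vQ) := by
  classical
  have hU : (⋃ i : Fin T.lstar, Function.support (b i)).Finite := Set.finite_iUnion hb
  have hsub : ∀ i : Fin T.lstar, Function.support (b i) ⊆ ↑hU.toFinset := fun i vQ hv => by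
    rw [Set.Finite.coe_toFinset]
    exact Set.mem_iUnion.2 ⟨i, hv⟩
  have hsub' : (Function.support fun vQ : T.VQ => processionNormalized (fun i : Fin T.lstar => b i vQ)) ⊆ ↑hU.toFinset := by
    intro vQ hv
    rw [Set.Finite.coe_toFinset, Set.mem_iUnion]
    by_contra hnot
    push Not at hnot
    apply hv
    have h0 : (fun i : Fin T.lstar => b i vQ) = fun _ => 0 := funext fun i => by
      by_contra hne
      exact hnot i hne
    show processionNormalized (fun i : Fin T.lstar => b i vQ) = 0
    rw [h0]
    unfold processionNormalized
    simp
  rw [finsum_eq_sum_of_support_subset _ hsub']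
  simp only [fun i => finsum_eq_sum_of_support_subset _ (hsub i)]
  unfold processionNormalized
  rw [Finset.sum_comm, Finset.sum_div]

/-- **THE R-W MARGIN PLACE BY PLACE**: under `ThetaFinite`, `PN(i ↦ Σᶠ_{v_ℚ} σ_{i+1,v_ℚ}) = Σᶠ_{v_ℚ} PN(i ↦ σ_{i+1,v_ℚ})` — the averaged cell slack is the
sum over places of the PLACE AVERAGE of the slacks at that place. [claim: Mochizuki2012, status: disputed] -/
theorem avg_cellSlack_eq_finsum_placeAvg (hfin : P.ThetaFinite) :
    processionNormalized (fun i : Fin T.lstar =>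
        ∑ᶠ vQ : T.VQ, ((S.D P.n).logvol _ vQ (P.thetaHull (Setting.labelSucc i) vQ) - P.qLocal (Setting.labelSucc i) vQ)) =
      ∑ᶠ vQ : T.VQ, processionNormalized (fun i : Fin T.lstar =>
        (S.D P.n).logvol _ vQ (P.thetaHull (Setting.labelSucc i) vQ) - P.qLocal (Setting.labelSucc i) vQ) :=
  avg_finsum_comm (b := fun i vQ => (S.D P.n).logvol _ vQ (P.thetaHull (Setting.labelSucc i) vQ) - P.qLocal (Setting.labelSucc i) vQ)
    (cellSlack_support_finite S P hfin)

/-- **THE TYPED COROLLARY PLACE BY PLACE**: `Statement ↔ 0 ≤ Σᶠ_{v_ℚ} PN(i ↦ σ_{i+1,v_ℚ})` (`ThetaFinite` only). [claim: Mochizuki2012, status: disputed] -/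
theorem statement_iff_finsum_placeAvg_nonneg (hfin : P.ThetaFinite) :
    P.Statement ↔ 0 ≤ ∑ᶠ vQ : T.VQ, processionNormalized (fun i : Fin T.lstar =>
        (S.D P.n).logvol _ vQ (P.thetaHull (Setting.labelSucc i) vQ) - P.qLocal (Setting.labelSucc i) vQ) := by
  rw [statement_iff_avg_cellSlack S P hfin, avg_cellSlack_eq_finsum_placeAvg S P hfin]

/-- The place average of the slacks is finitely supported over `v_ℚ` (`ThetaFinite`, Prop. 3.9 (iii)). [folklore] -/
theorem placeAvg_support_finite (hfin : P.ThetaFinite) :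
    (Function.support fun vQ : T.VQ => processionNormalized (fun i : Fin T.lstar =>
        (S.D P.n).logvol _ vQ (P.thetaHull (Setting.labelSucc i) vQ) - P.qLocal (Setting.labelSucc i) vQ)).Finite := by
  refine (Set.finite_iUnion (cellSlack_support_finite S P hfin)).subset fun vQ hv => ?_
  rw [Set.mem_iUnion]
  by_contra hnot
  push Not at hnot
  apply hv
  have h0 : (fun i : Fin T.lstar =>
      (S.D P.n).logvol _ vQ (P.thetaHull (Setting.labelSucc i) vQ) - P.qLocal (Setting.labelSucc i) vQ) = fun _ => 0 :=
    funext fun i => by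
      by_contra hne
      exact hnot i hne
  show processionNormalized _ = 0
  rw [h0]
  unfold processionNormalized
  simp

variable (V₀ : Set T.VQ)

/-- The sum over places splits into the places of `V₀` and the rest. [folklore] -/
theorem finsum_placeAvg_eq_on_add_off (hfin : P.ThetaFinite) :
    ∑ᶠ vQ : T.VQ, processionNormalized (fun i : Fin T.lstar =>
        (S.D P.n).logvol _ vQ (P.thetaHull (Setting.labelSucc i) vQ) - P.qLocal (Setting.labelSucc i) vQ) =
      (∑ᶠ vQ ∈ V₀, processionNormalized (fun i : Fin T.lstar =>
          (S.D P.n).logvol _ vQ (P.thetaHull (Setting.labelSucc i) vQ) - P.qLocal (Setting.labelSucc i) vQ)) +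
        ∑ᶠ vQ ∈ V₀ᶜ, processionNormalized (fun i : Fin T.lstar =>
          (S.D P.n).logvol _ vQ (P.thetaHull (Setting.labelSucc i) vQ) - P.qLocal (Setting.labelSucc i) vQ) := by
  rw [Set.compl_eq_univ_sdiff, finsum_mem_add_sdiff' (Set.subset_univ V₀) (by simpa using placeAvg_support_finite S P hfin),
    finsum_mem_univ]

/-- **PLACE BUDGET.** For every set of places `V₀`: `Statement ↔ 0 ≤ Σᶠ_{v ∈ V₀} placeAvg + Σᶠ_{v ∉ V₀} placeAvg` (`ThetaFinite`).
[claim: Mochizuki2012, status: disputed] -/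
theorem statement_iff_place_budget (hfin : P.ThetaFinite) :
    P.Statement ↔ 0 ≤
      (∑ᶠ vQ ∈ V₀, processionNormalized (fun i : Fin T.lstar =>
          (S.D P.n).logvol _ vQ (P.thetaHull (Setting.labelSucc i) vQ) - P.qLocal (Setting.labelSucc i) vQ)) +
        ∑ᶠ vQ ∈ V₀ᶜ, processionNormalized (fun i : Fin T.lstar =>
          (S.D P.n).logvol _ vQ (P.thetaHull (Setting.labelSucc i) vQ) - P.qLocal (Setting.labelSucc i) vQ) := by
  rw [statement_iff_finsum_placeAvg_nonneg S P hfin, finsum_placeAvg_eq_on_add_off S P V₀ hfin]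

/-- On-`V₀` surplus is nonnegative when every cell at those places is volume-licensed (`0 ≤ σ` for all labels; e.g. I06⋆ at ALL labels of `𝔽_l^⋇` there,
via `ObstructionSS28Window.cellSlack_nonneg_of_starAt`). [folklore] -/
theorem onPlaces_nonneg_of_cells
    (hon : ∀ vQ ∈ V₀, ∀ i : Fin T.lstar,
      0 ≤ (S.D P.n).logvol _ vQ (P.thetaHull (Setting.labelSucc i) vQ) - P.qLocal (Setting.labelSucc i) vQ) :
    0 ≤ ∑ᶠ vQ ∈ V₀, processionNormalized (fun i : Fin T.lstar =>
        (S.D P.n).logvol _ vQ (P.thetaHull (Setting.labelSucc i) vQ) - P.qLocal (Setting.labelSucc i) vQ) := by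
  have hl : 0 < T.lstar := lt_of_lt_of_le (by norm_num) T.two_le_lstar
  refine finsum_nonneg fun vQ => finsum_nonneg fun hvQ => ?_
  calc (0 : ℝ) = processionNormalized (fun _ : Fin T.lstar => (0 : ℝ)) := (processionNormalized_const hl 0).symm
    _ ≤ _ := processionNormalized_mono fun i => hon vQ hvQ i

/-- **PLACE-CUT DOOR — sufficiency.** If every cell at the places of `V₀` is volume-licensed and the off-`V₀` deficit is at most the on-`V₀` surplus, the
typed Statement holds (`ThetaFinite`). [claim: Mochizuki2012, status: disputed] -/
theorem statement_of_placeCut_of_budget (hfin : P.ThetaFinite)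
    (hon : ∀ vQ ∈ V₀, ∀ i : Fin T.lstar,
      0 ≤ (S.D P.n).logvol _ vQ (P.thetaHull (Setting.labelSucc i) vQ) - P.qLocal (Setting.labelSucc i) vQ)
    (hbudget : -(∑ᶠ vQ ∈ V₀ᶜ, processionNormalized (fun i : Fin T.lstar =>
          (S.D P.n).logvol _ vQ (P.thetaHull (Setting.labelSucc i) vQ) - P.qLocal (Setting.labelSucc i) vQ)) ≤
      ∑ᶠ vQ ∈ V₀, processionNormalized (fun i : Fin T.lstar =>
          (S.D P.n).logvol _ vQ (P.thetaHull (Setting.labelSucc i) vQ) - P.qLocal (Setting.labelSucc i) vQ)) :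
    P.Statement := by
  rw [statement_iff_place_budget S P V₀ hfin]
  have _h0 := onPlaces_nonneg_of_cells S P V₀ hon
  linarith

/-- **PLACE-CUT with I06⋆ at all labels of the cut places** (q-pin, RP-I05, bridge hypotheses): I06⋆ at every cell of the places of `V₀` and the place
budget give the Statement — the volume door for seed cut (C2). [claim: Mochizuki2012, status: disputed] -/
theorem statement_of_starOnPlaces_of_budget (HB : BridgeHyps P) (hq : QPinned S P ρ qK) (hA : HInd3Hull S P ρ)
    (hon : ∀ vQ ∈ V₀, ∀ i : Fin T.lstar,
      ρ qK (Setting.labelSucc i) vQ ⊆ ⋃ m : ℤ, ρ (shellSat S P.n ((S.col P.n).frobΨ m)) (Setting.labelSucc i) vQ)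
    (hbudget : -(∑ᶠ vQ ∈ V₀ᶜ, processionNormalized (fun i : Fin T.lstar =>
          (S.D P.n).logvol _ vQ (P.thetaHull (Setting.labelSucc i) vQ) - P.qLocal (Setting.labelSucc i) vQ)) ≤
      ∑ᶠ vQ ∈ V₀, processionNormalized (fun i : Fin T.lstar =>
          (S.D P.n).logvol _ vQ (P.thetaHull (Setting.labelSucc i) vQ) - P.qLocal (Setting.labelSucc i) vQ)) :
    P.Statement :=
  statement_of_placeCut_of_budget S P V₀ HB.finite
    (fun vQ hvQ i => cellSlack_nonneg_of_starAt S P ρ qK HB hq hA i vQ (hon vQ hvQ i)) hbudget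

/-- **PLACE-CUT DOOR — necessity.** The typed Statement forces, for EVERY set of places `V₀`, «off-`V₀` deficit ≤ on-`V₀` surplus» (`ThetaFinite`).
[claim: Mochizuki2012, status: disputed] -/
theorem place_deficit_le_of_statement (hfin : P.ThetaFinite) (hS : P.Statement) :
    -(∑ᶠ vQ ∈ V₀ᶜ, processionNormalized (fun i : Fin T.lstar =>
          (S.D P.n).logvol _ vQ (P.thetaHull (Setting.labelSucc i) vQ) - P.qLocal (Setting.labelSucc i) vQ)) ≤
      ∑ᶠ vQ ∈ V₀, processionNormalized (fun i : Fin T.lstar =>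
          (S.D P.n).logvol _ vQ (P.thetaHull (Setting.labelSucc i) vQ) - P.qLocal (Setting.labelSucc i) vQ) := by
  have h := (statement_iff_place_budget S P V₀ hfin).1 hS
  linarith

/-- Off the cut, a place's average deficit never exceeds its average FLOOR (`ObstructionSS28Budget.cellSlack_ge_neg_floor_at` label by label): under the
bridge hypotheses, (ii)(b), the Θ-pin and honest scaling at every label of the place. [claim: Mochizuki2012, status: disputed] -/
theorem placeAvg_ge_neg_floorAvg (HB : BridgeHyps P) (hKumB : (S.col P.n).KummerB (S.D P.n)) (hΘ : ThetaPinned S P ρ) (vQ : T.VQ)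
    (hscaled : ∀ i : Fin T.lstar, (S.D P.n).logvol _ vQ (ρ (S.D P.n).Ψ (Setting.labelSucc i) vQ) =
      (((i : ℕ) + 1 : ℕ) : ℝ) ^ 2 * P.qLocal (Setting.labelSucc i) vQ) :
    -processionNormalized (fun i : Fin T.lstar => ((((i : ℕ) + 1 : ℕ) : ℝ) ^ 2 - 1) * (-P.qLocal (Setting.labelSucc i) vQ)) ≤
      processionNormalized (fun i : Fin T.lstar =>
        (S.D P.n).logvol _ vQ (P.thetaHull (Setting.labelSucc i) vQ) - P.qLocal (Setting.labelSucc i) vQ) := by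
  have h : processionNormalized (fun i : Fin T.lstar => -(((((i : ℕ) + 1 : ℕ) : ℝ) ^ 2 - 1) * (-P.qLocal (Setting.labelSucc i) vQ))) ≤
      processionNormalized (fun i : Fin T.lstar =>
        (S.D P.n).logvol _ vQ (P.thetaHull (Setting.labelSucc i) vQ) - P.qLocal (Setting.labelSucc i) vQ) :=
    processionNormalized_mono fun i => cellSlack_ge_neg_floor_at S P ρ HB hKumB hΘ i vQ (hscaled i)
  have hneg : processionNormalized (fun i : Fin T.lstar => -(((((i : ℕ) + 1 : ℕ) : ℝ) ^ 2 - 1) * (-P.qLocal (Setting.labelSucc i) vQ))) =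
      -processionNormalized (fun i : Fin T.lstar => ((((i : ℕ) + 1 : ℕ) : ℝ) ^ 2 - 1) * (-P.qLocal (Setting.labelSucc i) vQ)) := by
    unfold processionNormalized
    rw [Finset.sum_neg_distrib, neg_div]
  linarith

/-- **WORST-CASE PLACE-CUT DOOR.** Every cell at the places of `V₀` volume-licensed, honest scaling at every label off `V₀`, and «on-`V₀` surplus ≥ off-`V₀`
FLOOR MASS» (`Σᶠ_{v ∉ V₀} PN(i ↦ ((i+1)²−1)(−qLocal)) ≤ Σᶠ_{v ∈ V₀} placeAvg`) give the typed Statement — nothing about the hull off `V₀` is used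
(bridge hypotheses, (ii)(b), Θ-pin). [claim: Mochizuki2012, status: disputed] -/
theorem statement_of_placeCut_of_surplus_ge_floorMass (HB : BridgeHyps P) (hKumB : (S.col P.n).KummerB (S.D P.n)) (hΘ : ThetaPinned S P ρ)
    (hscaled_off : ∀ vQ ∉ V₀, ∀ i : Fin T.lstar, (S.D P.n).logvol _ vQ (ρ (S.D P.n).Ψ (Setting.labelSucc i) vQ) =
      (((i : ℕ) + 1 : ℕ) : ℝ) ^ 2 * P.qLocal (Setting.labelSucc i) vQ)
    (hon : ∀ vQ ∈ V₀, ∀ i : Fin T.lstar,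
      0 ≤ (S.D P.n).logvol _ vQ (P.thetaHull (Setting.labelSucc i) vQ) - P.qLocal (Setting.labelSucc i) vQ)
    (hbudget : (∑ᶠ vQ ∈ V₀ᶜ, processionNormalized (fun i : Fin T.lstar =>
          ((((i : ℕ) + 1 : ℕ) : ℝ) ^ 2 - 1) * (-P.qLocal (Setting.labelSucc i) vQ))) ≤
      ∑ᶠ vQ ∈ V₀, processionNormalized (fun i : Fin T.lstar =>
          (S.D P.n).logvol _ vQ (P.thetaHull (Setting.labelSucc i) vQ) - P.qLocal (Setting.labelSucc i) vQ)) :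
    P.Statement := by
  refine statement_of_placeCut_of_budget S P V₀ HB.finite hon (le_trans ?_ hbudget)
  -- off-V₀: −Σᶠ placeAvg ≤ Σᶠ floorAvg, by the pointwise bound and indicator bookkeeping
  have hfl : (Function.support (V₀ᶜ.indicator fun vQ : T.VQ => processionNormalized (fun i : Fin T.lstar =>
      ((((i : ℕ) + 1 : ℕ) : ℝ) ^ 2 - 1) * (-P.qLocal (Setting.labelSucc i) vQ)))).Finite := by
    rw [Set.support_indicator]
    refine ((Set.finite_iUnion (floor_support_finite S P)).subset fun vQ hv => ?_).inter_of_right _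
    rw [Set.mem_iUnion]
    by_contra hnot
    push Not at hnot
    apply hv
    have h0 : (fun i : Fin T.lstar => ((((i : ℕ) + 1 : ℕ) : ℝ) ^ 2 - 1) * (-P.qLocal (Setting.labelSucc i) vQ)) = fun _ => 0 :=
      funext fun i => by
        by_contra hne
        exact hnot i hne
    show processionNormalized _ = 0
    rw [h0]
    unfold processionNormalized
    simp
  have hsl : (Function.support (V₀ᶜ.indicator fun vQ : T.VQ => processionNormalized (fun i : Fin T.lstar =>
      (S.D P.n).logvol _ vQ (P.thetaHull (Setting.labelSucc i) vQ) - P.qLocal (Setting.labelSucc i) vQ))).Finite := by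
    rw [Set.support_indicator]
    exact (placeAvg_support_finite S P HB.finite).inter_of_right _
  have hsum : 0 ≤ (∑ᶠ vQ ∈ V₀ᶜ, processionNormalized (fun i : Fin T.lstar =>
        ((((i : ℕ) + 1 : ℕ) : ℝ) ^ 2 - 1) * (-P.qLocal (Setting.labelSucc i) vQ))) +
      ∑ᶠ vQ ∈ V₀ᶜ, processionNormalized (fun i : Fin T.lstar =>
        (S.D P.n).logvol _ vQ (P.thetaHull (Setting.labelSucc i) vQ) - P.qLocal (Setting.labelSucc i) vQ) := by
    rw [finsum_mem_def, finsum_mem_def, ← finsum_add_distrib hfl hsl]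
    refine finsum_nonneg fun vQ => ?_
    by_cases hV : vQ ∈ V₀
    · have hn : vQ ∉ V₀ᶜ := fun h => h hV
      simp only [Set.indicator_of_notMem hn, add_zero, le_refl]
    · have hm : vQ ∈ V₀ᶜ := hV
      simp only [Set.indicator_of_mem hm]
      have h := placeAvg_ge_neg_floorAvg S P ρ HB hKumB hΘ vQ (hscaled_off vQ hV)
      linarith
  linarith

end Places

end Summit.ABC.IUTFork.Repair.ObstructionSS28Places

end
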